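import Summits.CriticalPhenomena.PercolationContinuityZ3.Theorems.PercNearOneGluingNoHeavyLowerTailCILTwoGates
import Summits.CriticalPhenomena.PercolationContinuityZ3.Theorems.PercNearOneGluingNoHeavyLowerTailCILSetStarTools
import HarnessLib

/-!
# `NoHeavyLowerTail` (stmt-CriticalPhenomena-4575) — CIL for an observer whose region has at most two boundary relays
# (geometric form of the two-gate theorem)

Support file (prover `prim-hp-4`, hull-port prover #4, LP-duality technique; `--supports stmt-CriticalPhenomena-4575`).
No definitions, no named facts, no sorries.

`Theorems.cil_of_twoGates` (this seat) proves the cumulative isolation lemma for an observer `o` all of whose relay connections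
pass, AS EVENTS AND FOR EVERY CONFIGURATION, through two relays `b, b'`.  The hull-port programme states its cases geometrically:
`o` lies in a vertex set `R` free of relays (its Steiner region) every positive-weight edge out of which ends in `b` or `b'`
(the two HULL PORTS).  Configurations using a zero-weight edge may violate the pathwise gate property, but they are null.  This file
bridges the two formulations:

* `attached_le_of_twoGates_ae` — the two-gate inequality `μ(1 ≤ N ≤ j) ≤ μ(M_b ≤ j ∧ 1 ≤ N)` (`b` the better gate) assuming the gate
  property only on the full-measure support `{ω | every open edge has nonzero weight}`;
* `gate_of_region` — if `o ∈ R`, `R ∩ A = ∅`... (only `a ∉ R` is needed) and every positive-weight pair `{u, v}` with `u ∈ R`, `v ∉ R`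
  has `v ∈ {b, b'}`, then on the support every connection `o ↔ a` to a vertex `a ∉ R` passes through `b` or `b'`
  (the first exit of an open walk from `R`, via `CutObserver.SetStar.exists_gate_of_walk`);
* `cil_of_twoPortRegion` — hence for such an observer and relays `b, b' ∈ A` with `A ∩ R = ∅`, some relay `a ∈ A` has
  `μ(1 ≤ N ≤ j) ≤ μ(M_a ≤ j)` (the registered stub `stub_cumulativeIsolation` on the class "Steiner region with ≤ 2 ports"), for
  every level and every weighted graph.
-/

noncomputable section

namespace Summit.CriticalPhenomena.PercolationContinuityZ3.Theorems

open MeasureTheory Set Literature.Probability.LatticeModels Literature.Probability.Percolation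
open scoped Classical BigOperators

variable {n : ℕ}

namespace TwoPortRegion

open AttachedShift AttachedChampionObserverExchange CutObserver

/-- **Two gates, attached form, with the gate property only on the support.**  As `attached_le_of_twoGates`, but the
hypothesis `{o ↔ a} ⊆ {o ↔ b} ∪ {o ↔ b'}` is only required for configurations all of whose open edges have nonzero weight. -/
theorem attached_le_of_twoGates_ae (w : Sym2 (Fin n) → unitInterval) (A : Finset (Fin n)) (o b b' : Fin n) (j : ℕ)
    (hb : b ∈ A) (hb' : b' ∈ A)
    (hgate : ∀ ω : BondConfig (Fin n), (∀ e ∈ ω, w e ≠ 0) →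
      ∀ a ∈ A, ω ∈ (openConn o a : Set (BondConfig (Fin n))) → ω ∈ (openConn o b : Set (BondConfig (Fin n))) ∪ openConn o b')
    (hle : (prodBernoulli w).real {ω : BondConfig (Fin n) | (A.filter fun x => ω ∈ openConn b' x).card ≤ j} ≤
      (prodBernoulli w).real {ω : BondConfig (Fin n) | (A.filter fun x => ω ∈ openConn b x).card ≤ j}) :
    (prodBernoulli w).real {ω : BondConfig (Fin n) |
        1 ≤ (A.filter fun x => ω ∈ openConn o x).card ∧ (A.filter fun x => ω ∈ openConn o x).card ≤ j} ≤
      (prodBernoulli w).real {ω : BondConfig (Fin n) |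
        (A.filter fun x => ω ∈ openConn b x).card ≤ j ∧ 1 ≤ (A.filter fun x => ω ∈ openConn o x).card} := by
  set μ := prodBernoulli w with hμ
  set E : Set (BondConfig (Fin n)) := openConn o b with hE
  set F : Set (BondConfig (Fin n)) := openConn o b' with hF
  set Rb : Set (BondConfig (Fin n)) := {ω | (A.filter fun x => ω ∈ openConn b x).card ≤ j} with hRb
  set Ro : Set (BondConfig (Fin n)) := {ω | (A.filter fun x => ω ∈ openConn o x).card ≤ j} with hRo
  set G : Set (BondConfig (Fin n)) := {ω | ∀ e ∈ ω, w e ≠ 0} with hG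
  set L : Set (BondConfig (Fin n)) := {ω : BondConfig (Fin n) |
    1 ≤ (A.filter fun x => ω ∈ openConn o x).card ∧ (A.filter fun x => ω ∈ openConn o x).card ≤ j} with hL
  have hmeas : ∀ s : Set (BondConfig (Fin n)), MeasurableSet s := fun _ => MeasurableSet.of_discrete
  -- attachment on the support: `1 ≤ N → o ↔ b ∨ o ↔ b'`
  have hatt : ∀ ω : BondConfig (Fin n), ω ∈ G → 1 ≤ (A.filter fun x => ω ∈ openConn o x).card → ω ∈ E ∪ F := by
    intro ω hωG h1
    rw [Nat.one_le_iff_ne_zero, Ne, Finset.card_eq_zero, ← Ne, ← Finset.nonempty_iff_ne_empty,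
      Finset.filter_nonempty_iff] at h1
    obtain ⟨a, ha, hωa⟩ := h1
    exact hgate ω hωG a ha hωa
  -- converse attachment (no gate hypothesis needed)
  have hatt' : ∀ ω : BondConfig (Fin n), ω ∈ E ∪ F → 1 ≤ (A.filter fun x => ω ∈ openConn o x).card := by
    intro ω h
    rw [Nat.one_le_iff_ne_zero, Ne, Finset.card_eq_zero, ← Ne, ← Finset.nonempty_iff_ne_empty,
      Finset.filter_nonempty_iff]
    rcases h with h | h
    · exact ⟨b, hb, h⟩
    · exact ⟨b', hb', h⟩
  -- (1) `μ(L) = μ(L ∩ G) ≤ μ((E ∩ Rb) ∪ (F ∩ Eᶜ ∩ Ro))`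
  have hsub : L ∩ G ⊆ (E ∩ Rb) ∪ (F ∩ Eᶜ ∩ Ro) := by
    rintro ω ⟨⟨h1, hN⟩, hωG⟩
    by_cases hωE : ω ∈ E
    · left
      refine ⟨hωE, ?_⟩
      show (A.filter fun x => ω ∈ openConn b x).card ≤ j
      rwa [← card_eq_of_reachable A hωE]
    · rcases hatt ω hωG h1 with h | h
      · exact absurd h hωE
      · exact Or.inr ⟨⟨h, hωE⟩, hN⟩
  have hdisj1 : Disjoint (E ∩ Rb) (F ∩ Eᶜ ∩ Ro) := by
    rw [Set.disjoint_left]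
    rintro ω ⟨hωE, -⟩ ⟨⟨-, hωE'⟩, -⟩
    exact hωE' hωE
  have h1 : μ.real L ≤ μ.real (E ∩ Rb) + μ.real (F ∩ Eᶜ ∩ Ro) := by
    rw [← measureReal_inter_support w L, ← measureReal_union hdisj1 (hmeas _)]
    exact measureReal_mono hsub (measure_ne_top _ _)
  -- (2) shift the second piece
  have hshift := attached_avoid_shift w A o b' b j hle
  -- (3) `(E ∩ Rb) ∪ (F ∩ Eᶜ ∩ Rb) ⊆ target`
  have hdisj2 : Disjoint (E ∩ Rb) (F ∩ Eᶜ ∩ Rb) := by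
    rw [Set.disjoint_left]
    rintro ω ⟨hωE, -⟩ ⟨⟨-, hωE'⟩, -⟩
    exact hωE' hωE
  have hsub2 : (E ∩ Rb) ∪ (F ∩ Eᶜ ∩ Rb) ⊆ {ω : BondConfig (Fin n) |
      (A.filter fun x => ω ∈ openConn b x).card ≤ j ∧ 1 ≤ (A.filter fun x => ω ∈ openConn o x).card} := by
    rintro ω (⟨hωE, hω⟩ | ⟨⟨hωF, -⟩, hω⟩)
    · exact ⟨hω, hatt' ω (Or.inl hωE)⟩
    · exact ⟨hω, hatt' ω (Or.inr hωF)⟩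
  have h3 : μ.real (E ∩ Rb) + μ.real (F ∩ Eᶜ ∩ Rb) ≤ μ.real {ω : BondConfig (Fin n) |
      (A.filter fun x => ω ∈ openConn b x).card ≤ j ∧ 1 ≤ (A.filter fun x => ω ∈ openConn o x).card} := by
    rw [← measureReal_union hdisj2 (hmeas _)]
    exact measureReal_mono hsub2 (measure_ne_top _ _)
  linarith

open SetStar in
/-- **Gate property of a region with two ports, on the support.**  Let `o ∈ R` and suppose every positive-weight pair `s(u, v)`
with `u ∈ R`, `v ∉ R` has `v = b ∨ v = b'`.  Then for every configuration whose open edges all have nonzero weight and every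
`a ∉ R`: `o ↔ a` implies `o ↔ b` or `o ↔ b'` (first exit of an open walk from `R`). [folklore] -/
theorem gate_of_region (w : Sym2 (Fin n) → unitInterval) (R : Finset (Fin n)) (o b b' : Fin n) (hoR : o ∈ R)
    (hbdry : ∀ u ∈ R, ∀ v, v ∉ R → w s(u, v) ≠ 0 → v = b ∨ v = b')
    (ω : BondConfig (Fin n)) (hωG : ∀ e ∈ ω, w e ≠ 0) (a : Fin n) (haR : a ∉ R)
    (hoa : ω ∈ (openConn o a : Set (BondConfig (Fin n)))) :
    ω ∈ (openConn o b : Set (BondConfig (Fin n))) ∪ openConn o b' := by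
  have hao : (openGraph ω).Reachable a o := (show (openGraph ω).Reachable o a from hoa).symm
  obtain ⟨u, huR, ⟨v, hvR, huv⟩, hau⟩ := exists_gate_of_reachable (S := R) haR hoR hao
  -- the exit edge `s(u, v)` is open, hence has nonzero weight, hence `u` is a port
  have hw : w s(v, u) ≠ 0 := by rw [Sym2.eq_swap]; exact hωG _ huv
  have hou : (openGraph ω).Reachable o u :=
    (show (openGraph ω).Reachable o a from hoa).trans (reachable_mono inter_subset_left hau)
  rcases hbdry v hvR u huR hw with rfl | rfl
  · exact Or.inl hou
  · exact Or.inr hou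

end TwoPortRegion

open TwoPortRegion in
/-- **CIL for every observer whose region has at most two ports.**  Let `o ∈ R`, let no relay lie in `R`, and let every
positive-weight pair leaving `R` end in one of two relays `b, b' ∈ A` (the hull ports of `o`; inside `R` and away from it the weighted
graph is arbitrary).  Then for every level `j` some relay `a ∈ A` satisfies `μ(1 ≤ N ≤ j) ≤ μ(M_a ≤ j)` — the registered stub
`stub_cumulativeIsolation` of crux `NoHeavyLowerTail` on this class; witness = the port that is more often light.
[two-cluster exchange of VandenbergHaggstromKahn2005, Thm. 1.5, via the shift row; gate lemma folklore] -/
theorem cil_of_twoPortRegion (w : Sym2 (Fin n) → unitInterval) (A R : Finset (Fin n)) (o b b' : Fin n) (j : ℕ)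
    (hoR : o ∈ R) (hRA : ∀ a ∈ A, a ∉ R) (hb : b ∈ A) (hb' : b' ∈ A)
    (hbdry : ∀ u ∈ R, ∀ v, v ∉ R → w s(u, v) ≠ 0 → v = b ∨ v = b') :
    ∃ a ∈ A,
      (prodBernoulli w).real {ω : BondConfig (Fin n) |
          1 ≤ (A.filter fun x => ω ∈ openConn o x).card ∧ (A.filter fun x => ω ∈ openConn o x).card ≤ j} ≤
        (prodBernoulli w).real {ω : BondConfig (Fin n) | (A.filter fun x => ω ∈ openConn a x).card ≤ j} := by
  have hgate : ∀ ω : BondConfig (Fin n), (∀ e ∈ ω, w e ≠ 0) →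
      ∀ a ∈ A, ω ∈ (openConn o a : Set (BondConfig (Fin n))) →
        ω ∈ (openConn o b : Set (BondConfig (Fin n))) ∪ openConn o b' :=
    fun ω hωG a ha hoa => gate_of_region w R o b b' hoR hbdry ω hωG a (hRA a ha) hoa
  have hgate' : ∀ ω : BondConfig (Fin n), (∀ e ∈ ω, w e ≠ 0) →
      ∀ a ∈ A, ω ∈ (openConn o a : Set (BondConfig (Fin n))) →
        ω ∈ (openConn o b' : Set (BondConfig (Fin n))) ∪ openConn o b :=
    fun ω hωG a ha hoa => (union_comm _ _).subset (hgate ω hωG a ha hoa)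
  rcases le_total
      ((prodBernoulli w).real {ω : BondConfig (Fin n) | (A.filter fun x => ω ∈ openConn b' x).card ≤ j})
      ((prodBernoulli w).real {ω : BondConfig (Fin n) | (A.filter fun x => ω ∈ openConn b x).card ≤ j}) with h | h
  · refine ⟨b, hb, (attached_le_of_twoGates_ae w A o b b' j hb hb' hgate h).trans ?_⟩
    exact measureReal_mono (fun ω hω => hω.1) (measure_ne_top _ _)
  · refine ⟨b', hb', (attached_le_of_twoGates_ae w A o b' b j hb' hb hgate' h).trans ?_⟩
    exact measureReal_mono (fun ω hω => hω.1) (measure_ne_top _ _)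

end Summit.CriticalPhenomena.PercolationContinuityZ3.Theorems

end
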